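import Literature.Topology.FourManifolds.FibredKnot
import HarnessLib

/-!
# Fibred knots: the page framing and `0`-surgery (named facts)

Two standard facts about a fibred knot `K ⊂ S³` with capped fibre `F`, puncture `p` and capped
monodromy `φ` (`Literature.Topology.FourManifolds.Knot.FibresWithVia K ν F p φ`, file
`FibredKnot.lean`), vendored as named facts (`def … : Prop`, D-0014) because their proofs are long
formalisations (a surface-bounds-hence-null-homologous argument in `π₁ᵃᵇ`, resp. the pasting of
smooth structures along the capping disc plus uniqueness of integral surgery):

* `Literature.Topology.FourManifolds.Knot.hasFraming_zero_of_fibresWithVia` — **the page framing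
  is the Seifert framing**: the binding neighbourhood `ν` of a fibration has framing `0`
  (`ν.HasFraming 0`). The pages are interiors of Seifert surfaces (Juhász 2023, Def. 4.64), the
  framing a Seifert surface induces is the Seifert framing (Juhász 2023, Rem. 4.12), and in the
  tree's convention (`Knot.TubularNbhd.HasFraming`: `[longitude] = m • [meridian]` in
  `π₁(S³ ∖ K)ᵃᵇ`) the Seifert framing is `m = 0` because the longitude bounds the compact
  orientable surface "page minus a collar of the binding" in the complement.
* `Literature.Topology.FourManifolds.Knot.isMappingTorusOf_of_fibresWithVia` — **`0`-surgery on
  a fibred knot is the mapping torus of the capped monodromy**: every `0`-surgery `Y` on `K` is a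
  smooth mapping torus of `φ` (Gabai, J. Differential Geom. 26 (1987), proof of Cor. 8.19, p. 530:
  "extend the given fibration of `S³ − N(k)` to a fibration on `M` by attaching discs to the
  boundary of each fiber"; Abe–Tagami 2016, §5.5: `S³₀(K)` "is the surface bundle over `S¹`"
  whose monodromy is the closed monodromy).

Both are stated with the binder list of the stubs `stub_pageFraming`,
`stub_zeroSurgery_of_fibresWithVia` of the crux line `monodromy-kernel-engine`
(`Summits/SmoothPoincare4`, item stmt-SmoothPoincare4-0366), except that the printed form of the
second has no framing hypothesis; the stub's form (with the redundant hypothesis `ν.HasFraming 0`)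
is the proved corollary `Knot.isMappingTorusOf_of_fibresWithVia.of_hasFraming`, and the
`FibresWith` form is `Knot.isMappingTorusOf_of_fibresWith`.

Not here: the converse (Gabai 1987, Cor. 8.19 `⇐`: if `S³₀(K)` fibres over `S¹` then `K` is
fibred), and uniqueness of the monodromy of a surface bundle with `b₁ = 1` up to conjugacy
(Abe–Tagami 2016, §5.5).

## References

* A. Juhász, *Differential and Low-Dimensional Topology*, CUP (2023), Def. 4.64 (p. 139),
  Rem. 4.12 (p. 122).
* D. Gabai, *Foliations and the topology of 3-manifolds. III*, J. Differential Geom. 26 (1987),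
  479–536, Cor. 8.19 (p. 529) and its proof (p. 530).
* T. Abe, K. Tagami, *Fibered knots with the same `0`-surgery and the slice-ribbon conjecture*,
  Math. Res. Lett. 23 (2016), App. B §5.5 (arXiv:1502.01102 numbering).
-/

open scoped Manifold ContDiff Topology
open Function Set

noncomputable section

namespace Literature.Topology.FourManifolds

/-- Local notation: `𝔼 n` is the model Euclidean space `EuclideanSpace ℝ (Fin n)`. -/
local notation "𝔼 " n:arg => EuclideanSpace ℝ (Fin n)

/-- **The page framing of a fibred knot is the Seifert framing (`0`).** If the knot `K` fibres
through the oriented tubular neighbourhood `ν` with closed connected smooth capped fibre `F`,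
puncture `p` and capped monodromy `φ` (`K.FibresWithVia ν F p φ`), then `ν` has framing `0`,
`ν.HasFraming 0`: the longitude `θ ↦ ν (e^{2πiθ}, e₀)`, `e₀ = (½, 0)`, of `ν` is — by the
standard-open-book clause at radius `½` and page angle `1` — the circle
`θ ↦ jB (d (½ e^{2πiθ}), 1)` of radius `½` around the puncture on one page, which bounds the
compact orientable surface `jB ((F ∖ d(½ D̊²)) × {1})` inside `S³ ∖ K`; a loop bounding an
embedded compact orientable surface is a product of commutators, so its class in
`π₁(S³ ∖ K)ᵃᵇ` is trivial, which is `ν.HasFraming 0` verbatim. In the literature's words: the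
pages are (interiors of) Seifert surfaces (Juhász 2023, Def. 4.64) and the framing induced by a
Seifert surface is the well-defined Seifert framing (Juhász 2023, Rem. 4.12), the zero of the
tree's framing convention `Knot.TubularNbhd.HasFraming`. Binder list of the stub
`stub_pageFraming` of the crux line `monodromy-kernel-engine`. Named fact (D-0014).
[cite: Juhasz2023, Rem. 4.12 and Def. 4.64] -/
def Knot.hasFraming_zero_of_fibresWithVia : Prop :=
  ∀ (K : Knot) (ν : Knot.TubularNbhd K) (F : Type) [TopologicalSpace F] [T2Space F]
    [SecondCountableTopology F] [ChartedSpace (𝔼 2) F] [IsManifold (𝓡 2) ∞ F] [CompactSpace F]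
    [ConnectedSpace F] (p : F) (φ : F ≃ₘ⟮𝓡 2, 𝓡 2⟯ F),
    K.FibresWithVia ν F p φ → ν.HasFraming 0

/-- A knot fibred with a closed connected smooth capped fibre fibres through a `0`-framed binding
neighbourhood (`Knot.FibresWith` form of `Knot.hasFraming_zero_of_fibresWithVia`).
[cite: Juhasz2023, Rem. 4.12 and Def. 4.64] -/
theorem Knot.FibresWith.exists_hasFraming_zero (h : Knot.hasFraming_zero_of_fibresWithVia)
    {K : Knot} {F : Type} [TopologicalSpace F] [T2Space F] [SecondCountableTopology F]
    [ChartedSpace (𝔼 2) F] [IsManifold (𝓡 2) ∞ F] [CompactSpace F] [ConnectedSpace F]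
    {p : F} {φ : F ≃ₘ⟮𝓡 2, 𝓡 2⟯ F} (hK : K.FibresWith F p φ) :
    ∃ ν : Knot.TubularNbhd K, ν.HasFraming 0 ∧ K.FibresWithVia ν F p φ := by
  obtain ⟨ν, hν⟩ := hK
  exact ⟨ν, h K ν F p φ hν, hν⟩

/-- **`0`-surgery on a fibred knot is the mapping torus of the capped monodromy.** If `K`
fibres through `ν` with closed connected smooth capped fibre `F`, puncture `p` and capped
monodromy `φ`, and `Y` is ANY `0`-surgery on `K` (`IsIntegralSurgery (𝓡 3) Y K 0`, a Hausdorff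
second countable smooth `3`-manifold), then `Y` is a smooth mapping torus of `φ`
(`IsMappingTorusOf (𝓡 3) Y φ`). Proof in the sources: the binding neighbourhood of a fibration
carries the page (= Seifert) framing `0` (`Knot.hasFraming_zero_of_fibresWithVia`), so
`0`-surgery glues the meridian discs `{(w, v)}` of the new solid torus onto the pages
(`surgeryRel ν`: `(r • u, v) ∼ ν (u, r • v)`, which by the standard-open-book clause is the collar
point `d (r • u)` of the page of angle `v`); the fibration of `S³ ∖ K` with fibre `F ∖ {p}`
therefore extends over the solid torus to a fibration of `Y_ν` with fibre `F` ("extend the given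
fibration of `S³ − N(k)` to a fibration on `M` by attaching discs to the boundary of each
fiber", Gabai 1987, proof of Cor. 8.19, p. 530) whose monodromy is the capped monodromy
`φ = φ| ∪ id` (`Knot.FibresWithVia.exists_disc_fixed`; Abe–Tagami 2016, §5.5: `S³₀(K)` is the
surface bundle over `S¹` with monodromy the closed monodromy); finally any `0`-surgery `Y` is
diffeomorphic to `Y_ν` (uniqueness of integral surgery with a fixed framing,
`nonempty_diffeomorph_of_isIntegralSurgery`) and smooth mapping tori transport along
diffeomorphisms of equally modelled manifolds (`IsMappingTorusOf.of_diffeomorph_of_range_eq`).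
Printed form (no framing hypothesis); the stub `stub_zeroSurgery_of_fibresWithVia` of the crux
line `monodromy-kernel-engine` is the corollary `….of_hasFraming`. Named fact (D-0014).
[cite: AbeTagami2016, App. B §5.5] -/
def Knot.isMappingTorusOf_of_fibresWithVia : Prop :=
  ∀ (K : Knot) (ν : Knot.TubularNbhd K) (F : Type) [TopologicalSpace F] [T2Space F]
    [SecondCountableTopology F] [ChartedSpace (𝔼 2) F] [IsManifold (𝓡 2) ∞ F] [CompactSpace F]
    [ConnectedSpace F] (p : F) (φ : F ≃ₘ⟮𝓡 2, 𝓡 2⟯ F)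
    (Y : Type) [TopologicalSpace Y] [T2Space Y] [SecondCountableTopology Y]
    [ChartedSpace (𝔼 3) Y] [IsManifold (𝓡 3) ∞ Y],
    K.FibresWithVia ν F p φ → IsIntegralSurgery (𝓡 3) Y K 0 → IsMappingTorusOf (𝓡 3) Y φ

/-- The stub form of `Knot.isMappingTorusOf_of_fibresWithVia` (crux line `monodromy-kernel-engine`,
`stub_zeroSurgery_of_fibresWithVia`): with the redundant framing hypothesis `ν.HasFraming 0`.
[cite: AbeTagami2016, App. B §5.5] -/
theorem Knot.isMappingTorusOf_of_fibresWithVia.of_hasFraming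
    (h : Knot.isMappingTorusOf_of_fibresWithVia) :
    ∀ (K : Knot) (ν : Knot.TubularNbhd K) (F : Type) [TopologicalSpace F] [T2Space F]
      [SecondCountableTopology F] [ChartedSpace (𝔼 2) F] [IsManifold (𝓡 2) ∞ F] [CompactSpace F]
      [ConnectedSpace F] (p : F) (φ : F ≃ₘ⟮𝓡 2, 𝓡 2⟯ F)
      (Y : Type) [TopologicalSpace Y] [T2Space Y] [SecondCountableTopology Y]
      [ChartedSpace (𝔼 3) Y] [IsManifold (𝓡 3) ∞ Y],
      K.FibresWithVia ν F p φ → ν.HasFraming 0 → IsIntegralSurgery (𝓡 3) Y K 0 →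
        IsMappingTorusOf (𝓡 3) Y φ :=
  fun K ν F _ _ _ _ _ _ _ p φ Y _ _ _ _ _ hK _ hY => h K ν F p φ Y hK hY

/-- **Every `0`-surgery on a fibred knot is the mapping torus of its capped monodromy**
(`Knot.FibresWith` form, the binding neighbourhood forgotten): from the named fact
`Knot.isMappingTorusOf_of_fibresWithVia`. [cite: AbeTagami2016, App. B §5.5] -/
theorem Knot.isMappingTorusOf_of_fibresWith (h : Knot.isMappingTorusOf_of_fibresWithVia)
    {K : Knot} {F : Type} [TopologicalSpace F] [T2Space F] [SecondCountableTopology F]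
    [ChartedSpace (𝔼 2) F] [IsManifold (𝓡 2) ∞ F] [CompactSpace F] [ConnectedSpace F]
    {p : F} {φ : F ≃ₘ⟮𝓡 2, 𝓡 2⟯ F}
    {Y : Type} [TopologicalSpace Y] [T2Space Y] [SecondCountableTopology Y]
    [ChartedSpace (𝔼 3) Y] [IsManifold (𝓡 3) ∞ Y]
    (hK : K.FibresWith F p φ) (hY : IsIntegralSurgery (𝓡 3) Y K 0) :
    IsMappingTorusOf (𝓡 3) Y φ := by
  obtain ⟨ν, hν⟩ := hK
  exact h K ν F p φ Y hν hY

end Literature.Topology.FourManifolds
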